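import Summits.ResolutionOfSingularities.ResolutionOfSingularities.Theorems.ValuativeLuAlphaPTorsorAdaptedDefs
import Summits.ResolutionOfSingularities.ResolutionOfSingularities.Theorems.ValuativeLuAlphaPTorsorResidualChartTransfer
import Summits.ResolutionOfSingularities.ResolutionOfSingularities.Theorems.ValuativeLuAlphaPTorsorResidualChartValues
import Literature.AlgebraicGeometry.Resolution.CompositeValuations
import Literature.AlgebraicGeometry.Resolution.TranscendenceDefect
import Mathlib.RingTheory.Adjoin.FG
import HarnessLib

/-!
# The residual chart of an adapted chart (stub F⁴ᵇ of the rank `≥ 2` Abhyankar core)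

Crux `Valuative.LuAlphaPTorsor` (stmt-ResolutionOfSingularities-0641), line
`pfaff-line-log-final-forms`, stub `stub_residualChart` of the skeleton reshape v6.2–v6.3 (lead c4):
the level induction of the monomialization on charts ADAPTED to the flag of convex subgroups of
a valuation of rank `≥ 2` (`…Theorems.ValuativeLuAlphaPTorsorAdaptedDefs`: `AdaptedValues`,
`AdaptedChart`) is pushed one level down through the RESIDUAL CHART.

Statement. Let `(R, x, lv)` be an adapted chart along `O` with `k ⊆ O`, `top` its highest level
(some parameter has level `top`, some has level `< top`), and `W ⊇ O` the top coarsening, given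
through the membership characterization `z ∈ W ↔ ν z ≤ ν(x^m)` for some `m` supported on the
levels `< top`. With the `k`-algebra structure `algebraOfMem k W _` on `W` (and on its residue
field `κ(W)`), the image `R̄` of `R` under the residue map `π : W → κ(W)` is an adapted chart
along the residue valuation ring `Ō = O/𝔪_W` of `κ(W)` (`residueValuationSubring`,
`CompositeValuations.lean`), with parameters the residues `x̄_j` of the lower parameters
(enumerated by `e : Fin nS ≃ {i // lv i < top}`) and the same levels; moreover
(a) for `r ∈ R`, `π r = 0` iff `r` lies in the ideal of `R` generated by the top parameters, and
(b) for `W`-units `r, r' ∈ R`, `ν̄(π r) ≤ ν̄(π r') ↔ ν(r) ≤ ν(r')`.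

Proof. `R̄` is the range of the `k`-algebra map `R → W → κ(W)` (finitely generated as the image
of `R`, inside `Ō` by `residue_mem_residueValuationSubring_iff`). The dictionary (b) is
`ȳ/ȳ' = (y/y')‾ ∈ Ō ↔ y/y' ∈ O` (`…ResidualChartHelpers`), extended to Laurent monomials in the
`W`-units `x_{<top}` (the residue of a monomial in units is the monomial of the residues); (a) is
clause (C3) at level `top` together with the description of the non-units of `W`. Every clause
of `AdaptedChart` for `(Ō, R̄, x̄, lv ∘ e)` is then the transfer of the corresponding clause for
`(O, R, x, lv)` restricted to exponents supported on the lower levels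
(`…ResidualChartTransfer`: centre, independence, (C2a), (C2b), (C4), (C3) — the ideals
generated by parameters of level `≥ ℓ` correspond under `π` because the top parameters lie in the
kernel `(x_top) = 𝔪_W ∩ R` of `π` on `R`). [folklore] (Zariski–Samuel II, Ch. VI §10;
Cutkosky 2022 §4, the composite structure of very good parameters.)
-/

set_option linter.dupNamespace false

noncomputable section

open IsLocalRing Literature.AlgebraicGeometry.Resolution

namespace Summit.ResolutionOfSingularities.ResolutionOfSingularities.Theorems.PfaffLine

/-- **The residual chart** (stub F⁴ᵇ, reshape v6.3): for an adapted chart and its top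
coarsening `W`, the image `R̄` of `R` in the residue field `κ(W)` is a FLAG-ADAPTED chart (one level
fewer, parameters the residues of the lower parameters, same level map) for the residue valuation
ring `O/𝔪_W`, with the dictionary: kernel of `R → κ(W)` on `R` = the ideal of the top parameters;
comparison of residual values of `W`-units = comparison of `O`-values. [folklore] -/
theorem stub_residualChart :
    ∀ (k K : Type) [Field k] [Field K] [Algebra k K] (O : ValuationSubring K)
    (hk : ∀ c : k, algebraMap k K c ∈ O) (n : ℕ) (R : Subalgebra k K)
    (hRO : R.toSubring ≤ O.toSubring) (x : Fin n → K) (hx : ∀ i, x i ∈ R) (lv : Fin n → ℕ),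
    FlagAdaptedChart O R hRO x hx lv →
    ∀ (top : ℕ), (∀ i, lv i ≤ top) → (∃ i, lv i = top) → (∃ i, lv i < top) →
    ∀ (W : ValuationSubring K) (hOW : O ≤ W),
      (∀ z : K, z ∈ W ↔ ∃ m : Fin n → ℤ, (∀ j, top ≤ lv j → m j = 0) ∧
        O.valuation z ≤ ∏ j, O.valuation (x j) ^ (m j)) →
      letI := algebraOfMem k W (fun c => hOW (hk c))
      ∃ (nS : ℕ) (e : Fin nS ≃ {i : Fin n // lv i < top}) (Rb : Subalgebra k (ResidueField W))
        (hRb : Rb.toSubring ≤ (residueValuationSubring O W hOW).toSubring),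
        (∀ (r : K) (hr : r ∈ R), residue W ⟨r, hOW (hRO hr)⟩ ∈ Rb) ∧
        (∀ rb ∈ Rb, ∃ (r : K) (hr : r ∈ R), residue W ⟨r, hOW (hRO hr)⟩ = rb) ∧
        ∃ (hxb : ∀ j, residue W ⟨x (e j).1, hOW (hRO (hx (e j).1))⟩ ∈ Rb),
        FlagAdaptedChart (residueValuationSubring O W hOW) Rb hRb
          (fun j => residue W ⟨x (e j).1, hOW (hRO (hx (e j).1))⟩) hxb (fun j => lv (e j).1) ∧
        (∀ (r : K) (hr : r ∈ R), residue W ⟨r, hOW (hRO hr)⟩ = 0 ↔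
          (⟨r, hr⟩ : R.toSubring) ∈ Ideal.span (Set.range
            fun i : {i : Fin n // lv i = top} => (⟨x i.1, hx i.1⟩ : R.toSubring))) ∧
        (∀ (r r' : K) (hr : r ∈ R) (hr' : r' ∈ R), W.valuation r = 1 → W.valuation r' = 1 →
          ((residueValuationSubring O W hOW).valuation (residue W ⟨r, hOW (hRO hr)⟩) ≤
              (residueValuationSubring O W hOW).valuation (residue W ⟨r', hOW (hRO hr')⟩) ↔
            O.valuation r ≤ O.valuation r')) := by
  intro k K _ _ _ O hk n R hRO x hx lv hchart top htop _hT _hS W hOW hW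
  classical
  letI := algebraOfMem k W (fun c => hOW (hk c))
  obtain ⟨hchartA, hLA⟩ := (flagAdaptedChart_iff O R hRO x hx lv).mp hchart
  obtain ⟨hFG, hx0, hspan, hind, hvals, hC3⟩ := (adaptedChart_iff O R hRO x hx lv).mp hchartA
  obtain ⟨hC2a, hC2b, hC4⟩ := (adaptedValues_iff _ _).mp hvals
  rw [levelArchimedean_iff] at hLA
  -- the enumeration of the lower parameters
  set e : Fin (Fintype.card {i : Fin n // lv i < top}) ≃ {i : Fin n // lv i < top} :=
    (Fintype.equivFin {i : Fin n // lv i < top}).symm with he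
  -- the residue map `R → W → κ(W)` as a `k`-algebra map, and the image chart `R̄`
  let ι : R →ₐ[k] W :=
    { toFun := fun r => ⟨r, hOW (hRO r.2)⟩
      map_one' := rfl
      map_mul' := fun _ _ => rfl
      map_zero' := rfl
      map_add' := fun _ _ => rfl
      commutes' := fun _ => rfl }
  let ψ : R →ₐ[k] ResidueField W := (IsScalarTower.toAlgHom k W (ResidueField W)).comp ι
  have h1 : ∀ (r : K) (hr : r ∈ R), residue W ⟨r, hOW (hRO hr)⟩ ∈ ψ.range :=
    fun r hr => ⟨⟨r, hr⟩, rfl⟩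
  have h2 : ∀ rb ∈ ψ.range, ∃ (r : K) (hr : r ∈ R), residue W ⟨r, hOW (hRO hr)⟩ = rb := by
    rintro rb ⟨r, rfl⟩
    exact ⟨r, r.2, rfl⟩
  have hRb : ψ.range.toSubring ≤ (residueValuationSubring O W hOW).toSubring := by
    rintro v ⟨r, rfl⟩
    exact (residue_mem_residueValuationSubring_iff O W hOW _).mpr (hRO r.2)
  refine ⟨_, e, ψ.range, hRb, h1, h2, fun j => h1 _ (hx (e j).1), ?_, ?_, ?_⟩
  · -- the image chart is flag-adapted: clause by clause through the dictionary
    refine (flagAdaptedChart_iff _ _ _ _ _ _).mpr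
      ⟨(adaptedChart_iff _ _ _ _ _ _).mpr ⟨?_, ?_, ?_, ?_, ?_, ?_⟩, (levelArchimedean_iff _ _).mpr
        (residChart_C2b O W hOW R.toSubring hRO x hx lv top e hx0 hW hLA)⟩
    · rw [← Algebra.map_top]
      exact ((Subalgebra.fg_top R).mpr hFG).map ψ
    · exact residChart_residue_param_ne_zero O W hOW R.toSubring hRO x hx lv top e hx0 hW
    · exact residChart_span_eq_centre O W hOW R.toSubring hRO x hx lv top ψ.range.toSubring hRb
        h1 h2 e hx0 htop hW hC3 hspan
    · exact residChart_valIndep O W hOW R.toSubring hRO x hx lv top e hx0 hW hind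
    · exact (adaptedValues_iff _ _).mpr
        ⟨residChart_C2a O W hOW R.toSubring hRO x hx lv top e hx0 hW hC2a,
          residChart_C2b_gen O W hOW R.toSubring hRO x hx lv top e hx0 hW hC2b,
          residChart_C4 O W hOW R.toSubring hRO x hx lv top e hx0 hW hC4⟩
    · exact residChart_C3 O W hOW R.toSubring hRO x hx lv top ψ.range.toSubring h1 h2 e hx0
        htop hW hC3
  · exact residChart_residue_eq_zero_iff O W hOW R.toSubring hRO x hx lv top hx0 htop hW hC3
  · intro r r' hr hr' _ h1r'
    exact ap_resval_le_iff O W hOW _ _ h1r'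

end Summit.ResolutionOfSingularities.ResolutionOfSingularities.Theorems.PfaffLine

end
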